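import Summits.ResolutionOfSingularities.ResolutionOfSingularities.Theorems.FrobeniusClosingPatchingRelPerfectConeDepthChartKillQuot
import Summits.ResolutionOfSingularities.ResolutionOfSingularities.Theorems.FrobeniusClosingPatchingRelPerfectConeDepthConeCharts
import Literature.AlgebraicGeometry.Resolution.AdicCompletionRegular
import HarnessLib

/-!
# Crux `PatchingRelPerfect` (stmt-ResolutionOfSingularities-16161), chain W5.2 — rung «r-binary-disc-ℓ», local algebra: the
# binary form `N(c₁, c₂) = c₁² + b c₁c₂ + a c₂²` (`b² − 4a` a unit) on the charts of the blowing up of the LINE `V(c₀, c₁, c₂)`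

[OURS · L1 W5.2 · rung tool] Replaces the role of NO printed item; NOT a statement of the manuscript under review; fact-free,
any characteristic, any residue field.  AI-written (AI review is weaker than expert review).

`R` regular local with regular system of parameters `(c₀, c₁, c₂; w₁, …, w_l)` (`l = 1` at a closed point of the bad line, `l = 0` at its
generic point): the centre `I = (c₀, c₁, c₂)` is a regular germ (the bad line of the anisotropic/arbitrary binary form `N(c₁,c₂)`, `E = V(c₀)` the exceptional carrier through it).
On the chart `B_i` of `Bl_I` (`i ∈ {0,1,2}`, `e_j = c_j/c_i`): `φ(N(c₁,c₂)) = φ(c_i)² · f_i` with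
`f_i = e₁² + b e₁e₂ + a e₂²` (`e_i = 1`), and `B_i/(c_i) ≅ (R/I)[T_j : j ≠ i]` with `R/I` a DVR (the tree's `chartQuotEquiv`).
PROVED, by the Jacobian criterion over `R/I` (`isRsopPart_kill_hypersurface_of_equiv`) and the discriminant identities
`2a(2e₁+be₂) − b(be₁+2ae₂) = (4a−b²)e₁`, `4a f₁ − (b+2ae₂)² = 4a − b²`, `(2e₁+b)² − 4f₂ = b² − 4a`:
* `lineChart_zero` — chart `0` OFF the new line (`¬(e₁, e₂ ∈ 𝔓)`): `{φ c₀, f₀} ∩ 𝔓` is part of one regular system of parameters;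
* `lineChart_one`, `lineChart_two` — charts `1`, `2`: `{φ c_i, e₀, f_i} ∩ 𝔓` (exceptional divisor, old carrier, host) likewise;
* `lineVertex` — at the line point of chart `0` (`e₁, e₂ ∈ 𝔓`): `(φ c₀, e₁, e₂; φ w)` is a regular system of parameters of
  `L = (B₀)_𝔓` in which the host reads `e₁² + b e₁e₂ + a e₂²` again — the configuration reproduces one exceptional level up.

## References
* H. Matsumura, *Commutative Ring Theory*, CUP 1986, Thm. 14.2, Thm. 30.3. [Matsumura1987]
* The Stacks Project, Tags 0804, 0BIQ. [StacksProject]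
* J. Kollár, *Lectures on Resolution of Singularities* (2007), Def. 3.24. [Kollar2007]
-/

set_option linter.dupNamespace false

noncomputable section

open IsLocalRing Literature.AlgebraicGeometry.Resolution
open scoped Pointwise

namespace Summit.ResolutionOfSingularities.ResolutionOfSingularities.Theorems

universe u

namespace ConeDepth

section LineChart

variable {R : Type u} [CommRing R] [IsRegularLocalRing R] (c : Fin 3 → R) {l : ℕ} (w : Fin l → R)
  (hz : Ideal.span (Set.range (Fin.append c w)) = maximalIdeal R) (hd : (maximalIdeal R).spanFinrank = 3 + l)
  (a b : R) (i : Fin 3)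

/-! ### Generalities on the line charts -/

include hz in
/-- The centre coordinates lie in `𝔪`. [folklore] -/
theorem lineCentre_mem (j : Fin 3) : c j ∈ maximalIdeal R := by
  rw [← hz]
  exact Ideal.subset_span ⟨Fin.castAdd l j, by simp⟩

include hz in
/-- The free coordinate lies in `𝔪`. [folklore] -/
theorem lineFree_mem (k : Fin l) : w k ∈ maximalIdeal R := by
  rw [← hz]
  exact Ideal.subset_span ⟨Fin.natAdd 3 k, by simp⟩

include hz in
/-- `φ(c_j) ∈ 𝔓` for a prime of the chart over `𝔪`. [folklore] -/
theorem chartBase_lineCentre_mem (𝔓 : Ideal (chartRing c i)) (h𝔓 : 𝔓.comap (chartBase c i) = maximalIdeal R) (j : Fin 3) :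
    chartBase c i (c j) ∈ 𝔓 := by
  have h : c j ∈ 𝔓.comap (chartBase c i) := by rw [h𝔓]; exact lineCentre_mem c w hz j
  exact h

omit [IsRegularLocalRing R] in
/-- **`φ(N(c₁,c₂)) = φ(c_i)² · f_i`**, `f_i = e₁² + b e₁e₂ + a e₂²`. [folklore] -/
theorem chartBase_binaryForm :
    chartBase c i (c 1 * c 1 + b * (c 1 * c 2) + a * (c 2 * c 2)) =
      chartBase c i (c i) ^ 2 * (chartGen c i 1 * chartGen c i 1 + chartBase c i b * (chartGen c i 1 * chartGen c i 2) +
        chartBase c i a * (chartGen c i 2 * chartGen c i 2)) := by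
  rw [map_add, map_add, map_mul, map_mul, map_mul, map_mul, map_mul, reesChartBase_apply_eq_mul_chartGen c i 1,
    reesChartBase_apply_eq_mul_chartGen c i 2]
  ring

variable (𝔓 : Ideal (chartRing c i)) [𝔓.IsPrime] (h𝔓 : 𝔓.comap (chartBase c i) = maximalIdeal R)
  (L : Type u) [CommRing L] [IsLocalRing L] [Algebra (chartRing c i) L] [IsLocalization.AtPrime L 𝔓]

include hz hd h𝔓 in
/-- **The kill lemma on a line chart**: for a list `l` of killed generators in `𝔓` and `f ∈ 𝔓` with a non-zero representative
`F ∈ (R/I)[T_j : j ∉ l]` having a partial derivative with a lift outside `𝔓`, `(φ c_i, e_l, f)` is part of a regular system of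
parameters of `L` (`isRsopPart_kill_hypersurface_of_equiv` with `C = R/I`, a regular domain). [cite: Matsumura1987, Thm. 30.3] -/
theorem isRsopPart_lineKill (l : List {j : Fin 3 // j ≠ i}) (hl : l.Nodup) (hlu : ∀ j ∈ l, chartGen c i j.1 ∈ 𝔓)
    (f : chartRing c i) (hf : f ∈ 𝔓)
    (F : MvPolynomial {j : {j : Fin 3 // j ≠ i} // j ∉ {j : {j : Fin 3 // j ≠ i} | j ∈ l}} (R ⧸ Ideal.span (Set.range c)))
    (hF0 : F ≠ 0)
    (hfF : chartQuotEquiv c i (isQuasiRegular_centre c w hz hd) (MvPolynomial.rename Subtype.val F) = Ideal.Quotient.mk _ f)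
    (jv : {j : {j : Fin 3 // j ≠ i} // j ∉ {j : {j : Fin 3 // j ≠ i} | j ∈ l}}) (g : chartRing c i)
    (hGa : chartQuotEquiv c i (isQuasiRegular_centre c w hz hd) (MvPolynomial.rename Subtype.val (MvPolynomial.pderiv jv F)) =
      Ideal.Quotient.mk _ g) (hg : g ∉ 𝔓) :
    IsRsopPart (consFamily c i L (chartBase c i) (killFamily i (chartGen c i) l f)) := by
  haveI : IsNoetherianRing (chartRing c i) := isNoetherianRing_blowupChart c i
  haveI : IsRegularLocalRing (R ⧸ Ideal.span (Set.range c)) := isRegularLocalRing_quot_centre c w hz hd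
  haveI : IsDomain (R ⧸ Ideal.span (Set.range c)) := isDomain_of_isRegularLocalRing _
  haveI : IsRegularRing (R ⧸ Ideal.span (Set.range c)) := isRegularRing_of_isRegularLocalRing _
  exact isRsopPart_kill_hypersurface_of_equiv c i L (chartBase c i) (chartGen c i)
    (reesChartBase_mem_nonZeroDivisors (c i) (Ideal.mem_span_range_self (f := c) (x := i)))
    (chartQuotEquiv c i (isQuasiRegular_centre c w hz hd)) (fun j => chartQuotMap_X c i j) 𝔓
    (chartBase_lineCentre_mem c w hz i 𝔓 h𝔓 i) l hl hlu f hf F hF0 hfF jv g hGa hg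

include hz hd h𝔓 in
/-- The chart family `(φ c_i, e_J, φ w)` at the prime is part of a regular system of parameters (the tree's
`isRsopPart_chartFamily_reesChart`). [cite: StacksProject, Tag 0BIQ] -/
theorem isRsopPart_lineChartFamily {m : ℕ} (jJ : Fin m → {j : Fin 3 // j ≠ i}) (hjJ : Function.Injective jJ)
    (hJ : ∀ k, chartGen c i (jJ k).1 ∈ 𝔓) :
    IsRsopPart (chartFamily c i w L (chartBase c i) (chartGen c i) jJ) :=
  isRsopPart_chartFamily_reesChart c i w hz hd 𝔓 h𝔓 L jJ hjJ hJ

omit [IsRegularLocalRing R] [𝔓.IsPrime] [IsLocalization.AtPrime L 𝔓] in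
/-- Packaging a cons/kill family as an adapted family. [folklore] -/
theorem rsopAdapted_of_consFamily_killFamily₃ (l : List {j : Fin 3 // j ≠ i}) (f : chartRing c i)
    (h : IsRsopPart (consFamily c i L (chartBase c i) (killFamily i (chartGen c i) l f)))
    (gs : List (chartRing c i))
    (hgs : ∀ g ∈ gs, g ∈ 𝔓 → g = chartBase c i (c i) ∨ (∃ j ∈ l, g = chartGen c i j.1) ∨ g = f) :
    ∃ (m : ℕ) (v : Fin m → L) (ι : {g : chartRing c i // g ∈ gs ∧ g ∈ 𝔓} → Fin m),
      IsRsopPart v ∧ Function.Injective ι ∧ ∀ g, v (ι g) = (algebraMap (chartRing c i) L : chartRing c i →+* L) g.1 := by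
  refine rsopAdapted_of_cover (Fin.cons (chartBase c i (c i)) (killFamily i (chartGen c i) l f)) ?_ ?_
  · convert h using 1
    funext k
    refine Fin.cases rfl (fun k => ?_) k
    simp only [Fin.cons_succ, consFamily]
  · intro g hg hgP
    rcases hgs g hg hgP with rfl | ⟨j, hj, rfl⟩ | rfl
    · exact ⟨0, rfl⟩
    · obtain ⟨k, rfl⟩ := List.get_of_mem hj
      refine ⟨(Fin.castAdd 1 k).succ, ?_⟩
      rw [Fin.cons_succ, killFamily, Fin.append_left]
    · refine ⟨(Fin.natAdd l.length (0 : Fin 1)).succ, ?_⟩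
      rw [Fin.cons_succ, killFamily, Fin.append_right]

omit [IsRegularLocalRing R] [𝔓.IsPrime] [IsLocalization.AtPrime L 𝔓] in
/-- Packaging the chart family `(φ c_i, e_J, φ w)` as an adapted family for elements among `φ c_i`, the `e_J`. [folklore] -/
theorem rsopAdapted_of_lineChartFamily {m : ℕ} (jJ : Fin m → {j : Fin 3 // j ≠ i})
    (h : IsRsopPart (chartFamily c i w L (chartBase c i) (chartGen c i) jJ))
    (gs : List (chartRing c i)) (hgs : ∀ g ∈ gs, g ∈ 𝔓 → g = chartBase c i (c i) ∨ ∃ k, g = chartGen c i (jJ k).1) :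
    ∃ (m : ℕ) (v : Fin m → L) (ι : {g : chartRing c i // g ∈ gs ∧ g ∈ 𝔓} → Fin m),
      IsRsopPart v ∧ Function.Injective ι ∧ ∀ g, v (ι g) = (algebraMap (chartRing c i) L : chartRing c i →+* L) g.1 := by
  refine rsopAdapted_of_cover
    (Fin.cons (chartBase c i (c i)) (Fin.append (fun k => chartGen c i (jJ k).1) (fun k : Fin l => chartBase c i (w k)))) ?_ ?_
  · convert h using 1
    funext k
    refine Fin.cases rfl (fun k => ?_) k
    rw [Fin.cons_succ, chartFamily, Fin.cons_succ]
    refine Fin.addCases (m := m) (n := l) (fun k => ?_) (fun k => ?_) k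
    · rw [Fin.append_left, Fin.append_left]
    · rw [Fin.append_right, Fin.append_right]
  · intro g hg hgP
    rcases hgs g hg hgP with rfl | ⟨k, rfl⟩
    · exact ⟨0, rfl⟩
    · exact ⟨(Fin.castAdd l k).succ, by rw [Fin.cons_succ, Fin.append_left]⟩

/-! ### The discriminant identities at a prime -/

omit [IsRegularLocalRing R] in
/-- **Unit discriminant at a root** (one-variable forms, numeral-free): `4a(1 + b e + a e²) − (b + 2a e)² = 4a − b²` and
`(2e + b)² − 4(e² + b e + a) = b² − 4a`, so the derivative is not in a prime `𝔔` containing the value when `b² − 4a` is a unit.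
[folklore] -/
theorem partial_notMem_of_disc_unit {B : Type u} [CommRing B] (𝔔 : Ideal B) [𝔔.IsPrime] (a' b' e : B)
    (hD : IsUnit (b' ^ 2 - 4 * a')) :
    (1 + b' * e + a' * (e * e) ∈ 𝔔 → b' + (a' * e + a' * e) ∉ 𝔔) ∧ (e * e + b' * e + a' ∈ 𝔔 → e + e + b' ∉ 𝔔) := by
  constructor
  · intro hn hder
    have hmem : b' ^ 2 - 4 * a' ∈ 𝔔 := by
      have : b' ^ 2 - 4 * a' =
          (b' + (a' * e + a' * e)) * (b' + (a' * e + a' * e)) - (a' + a' + (a' + a')) * (1 + b' * e + a' * (e * e)) := by ring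
      rw [this]
      exact 𝔔.sub_mem (𝔔.mul_mem_left _ hder) (𝔔.mul_mem_left _ hn)
    exact Ideal.IsPrime.ne_top inferInstance (Ideal.eq_top_of_isUnit_mem _ hmem hD)
  · intro hn hder
    have hmem : b' ^ 2 - 4 * a' ∈ 𝔔 := by
      have : b' ^ 2 - 4 * a' = (e + e + b') * (e + e + b') - (1 + 1 + (1 + 1)) * (e * e + b' * e + a') := by ring
      rw [this]
      exact 𝔔.sub_mem (𝔔.mul_mem_left _ hder) (𝔔.mul_mem_left _ hn)
    exact Ideal.IsPrime.ne_top inferInstance (Ideal.eq_top_of_isUnit_mem _ hmem hD)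

end LineChart

/-! ### The three charts -/

section LineChartZero

variable {R : Type u} [CommRing R] [IsRegularLocalRing R] (c : Fin 3 → R) {l : ℕ} (w : Fin l → R)
  (hz : Ideal.span (Set.range (Fin.append c w)) = maximalIdeal R) (hd : (maximalIdeal R).spanFinrank = 3 + l)
  (a b : R) (hD : IsUnit (b ^ 2 - 4 * a))
  (𝔓 : Ideal (chartRing c 0)) [𝔓.IsPrime] (h𝔓 : 𝔓.comap (chartBase c 0) = maximalIdeal R)
  (L : Type u) [CommRing L] [IsLocalRing L] [Algebra (chartRing c 0) L] [IsLocalization.AtPrime L 𝔓]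

include hD in
omit [IsRegularLocalRing R] [IsLocalization.AtPrime L 𝔓] [IsLocalRing L] in
/-- **Chart `0`, off the line**: if not both `e₁, e₂ ∈ 𝔓`, then `e₁ + e₁ + b e₂ ∉ 𝔓` or `b e₁ + (a e₂ + a e₂) ∉ 𝔓`
(`b(be₁+2ae₂) − 2a(2e₁+be₂) = (b²−4a) e₁`, `b(2e₁+be₂) − 2(be₁+2ae₂) = (b²−4a) e₂`). [folklore] -/
theorem lineChart_zero_partial (hnl : ¬ (chartGen c 0 1 ∈ 𝔓 ∧ chartGen c 0 2 ∈ 𝔓)) :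
    (chartGen c 0 1 + chartGen c 0 1 + chartBase c 0 b * chartGen c 0 2) ∉ 𝔓 ∨
      (chartBase c 0 b * chartGen c 0 1 + (chartBase c 0 a * chartGen c 0 2 + chartBase c 0 a * chartGen c 0 2)) ∉ 𝔓 := by
  by_contra h
  simp only [not_or, not_not] at h
  obtain ⟨h1, h2⟩ := h
  have hDu : IsUnit (chartBase c 0 (b ^ 2 - 4 * a)) := hD.map _
  apply hnl
  constructor
  · have hmem : chartBase c 0 (b ^ 2 - 4 * a) * chartGen c 0 1 ∈ 𝔓 := by
      have : chartBase c 0 (b ^ 2 - 4 * a) * chartGen c 0 1 =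
          chartBase c 0 b * (chartBase c 0 b * chartGen c 0 1 + (chartBase c 0 a * chartGen c 0 2 + chartBase c 0 a * chartGen c 0 2)) -
            (chartBase c 0 a + chartBase c 0 a) * (chartGen c 0 1 + chartGen c 0 1 + chartBase c 0 b * chartGen c 0 2) := by
        rw [map_sub, map_pow, map_mul, map_ofNat]; ring
      rw [this]
      exact 𝔓.sub_mem (𝔓.mul_mem_left _ h2) (𝔓.mul_mem_left _ h1)
    exact (Ideal.IsPrime.mem_or_mem inferInstance hmem).resolve_left
      (fun hu => Ideal.IsPrime.ne_top inferInstance (Ideal.eq_top_of_isUnit_mem _ hu hDu))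
  · have hmem : chartBase c 0 (b ^ 2 - 4 * a) * chartGen c 0 2 ∈ 𝔓 := by
      have : chartBase c 0 (b ^ 2 - 4 * a) * chartGen c 0 2 =
          chartBase c 0 b * (chartGen c 0 1 + chartGen c 0 1 + chartBase c 0 b * chartGen c 0 2) -
            ((chartBase c 0 b * chartGen c 0 1 + (chartBase c 0 a * chartGen c 0 2 + chartBase c 0 a * chartGen c 0 2)) +
              (chartBase c 0 b * chartGen c 0 1 + (chartBase c 0 a * chartGen c 0 2 + chartBase c 0 a * chartGen c 0 2))) := by
        rw [map_sub, map_pow, map_mul, map_ofNat]; ring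
      rw [this]
      exact 𝔓.sub_mem (𝔓.mul_mem_left _ h1) (𝔓.add_mem h2 h2)
    exact (Ideal.IsPrime.mem_or_mem inferInstance hmem).resolve_left
      (fun hu => Ideal.IsPrime.ne_top inferInstance (Ideal.eq_top_of_isUnit_mem _ hu hDu))

include hz hd hD h𝔓 in
/-- **Chart `0` (the chart of the carrier) OFF the new line**: at a prime over `𝔪` not containing both `e₁, e₂`, the members of
`{φ c₀, f₀}` in `𝔓` are part of one regular system of parameters of `L`. [cite: Matsumura1987, Thm. 30.3] -/
theorem lineChart_zero (hnl : ¬ (chartGen c 0 1 ∈ 𝔓 ∧ chartGen c 0 2 ∈ 𝔓)) :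
    ∃ (m : ℕ) (v : Fin m → L)
      (ι : {g : chartRing c 0 // g ∈ [chartBase c 0 (c 0),
        chartGen c 0 1 * chartGen c 0 1 + chartBase c 0 b * (chartGen c 0 1 * chartGen c 0 2) +
          chartBase c 0 a * (chartGen c 0 2 * chartGen c 0 2)] ∧ g ∈ 𝔓} → Fin m),
      IsRsopPart v ∧ Function.Injective ι ∧ ∀ g, v (ι g) = (algebraMap (chartRing c 0) L : chartRing c 0 →+* L) g.1 := by
  classical
  set f := chartGen c 0 1 * chartGen c 0 1 + chartBase c 0 b * (chartGen c 0 1 * chartGen c 0 2) +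
    chartBase c 0 a * (chartGen c 0 2 * chartGen c 0 2) with hfdef
  haveI : Nontrivial (R ⧸ Ideal.span (Set.range c)) :=
    (isRegularLocalRing_quot_centre c w hz hd).toIsLocalRing.toNontrivial
  by_cases hf : f ∈ 𝔓
  · let σ := {j : {j : Fin 3 // j ≠ (0 : Fin 3)} //
      j ∉ {j : {j : Fin 3 // j ≠ (0 : Fin 3)} | j ∈ ([] : List {j : Fin 3 // j ≠ (0 : Fin 3)})}}
    let t1 : σ := ⟨⟨1, by decide⟩, by simp⟩
    let t2 : σ := ⟨⟨2, by decide⟩, by simp⟩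
    have h12 : t1 ≠ t2 := by decide
    let abar : R ⧸ Ideal.span (Set.range c) := Ideal.Quotient.mk _ a
    let bbar : R ⧸ Ideal.span (Set.range c) := Ideal.Quotient.mk _ b
    let F : MvPolynomial σ (R ⧸ Ideal.span (Set.range c)) :=
      MvPolynomial.X t1 * MvPolynomial.X t1 + MvPolynomial.C bbar * (MvPolynomial.X t1 * MvPolynomial.X t2) +
        MvPolynomial.C abar * (MvPolynomial.X t2 * MvPolynomial.X t2)
    have hε := chartQuotEquiv_apply c 0 (isQuasiRegular_centre c w hz hd)
    have hfF : chartQuotEquiv c 0 (isQuasiRegular_centre c w hz hd) (MvPolynomial.rename Subtype.val F) =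
        Ideal.Quotient.mk _ f := by
      simp only [F, map_add, map_mul, MvPolynomial.rename_X, MvPolynomial.rename_C, hε, chartQuotMap_X, chartQuotMap_C, hfdef,
        t1, t2, abar, bbar]
    have hF0 : F ≠ 0 := by
      intro h
      have h' := congrArg (MvPolynomial.eval (fun j : σ => if j = t1 then (1 : R ⧸ Ideal.span (Set.range c)) else 0)) h
      simp only [F, map_add, map_mul, MvPolynomial.eval_X, MvPolynomial.eval_C, if_true, if_neg h12.symm, mul_zero,
        add_zero, mul_one, map_zero] at h'
      exact one_ne_zero h'
    have hG1 : chartQuotEquiv c 0 (isQuasiRegular_centre c w hz hd)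
        (MvPolynomial.rename Subtype.val (MvPolynomial.pderiv t1 F)) =
        Ideal.Quotient.mk _ (chartGen c 0 1 + chartGen c 0 1 + chartBase c 0 b * chartGen c 0 2) := by
      have hp : MvPolynomial.pderiv t1 F = 2 * MvPolynomial.X t1 + MvPolynomial.C bbar * MvPolynomial.X t2 := by
        simp only [F, map_add, Derivation.leibniz, MvPolynomial.pderiv_X_self, MvPolynomial.pderiv_X_of_ne h12.symm,
          MvPolynomial.pderiv_C, smul_eq_mul, mul_one, mul_zero, add_zero]
        ring
      rw [hp]
      simp only [map_add, map_mul, map_ofNat, MvPolynomial.rename_X, MvPolynomial.rename_C, hε, chartQuotMap_X,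
        chartQuotMap_C, t1, t2, bbar]
      ring
    have hG2 : chartQuotEquiv c 0 (isQuasiRegular_centre c w hz hd)
        (MvPolynomial.rename Subtype.val (MvPolynomial.pderiv t2 F)) =
        Ideal.Quotient.mk _ (chartBase c 0 b * chartGen c 0 1 +
          (chartBase c 0 a * chartGen c 0 2 + chartBase c 0 a * chartGen c 0 2)) := by
      have hp : MvPolynomial.pderiv t2 F =
          MvPolynomial.C bbar * MvPolynomial.X t1 + 2 * MvPolynomial.C abar * MvPolynomial.X t2 := by
        simp only [F, map_add, Derivation.leibniz, MvPolynomial.pderiv_X_self, MvPolynomial.pderiv_X_of_ne h12,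
          MvPolynomial.pderiv_C, smul_eq_mul, mul_one, mul_zero, add_zero, zero_add]
        ring
      rw [hp]
      simp only [map_add, map_mul, map_ofNat, MvPolynomial.rename_X, MvPolynomial.rename_C, hε, chartQuotMap_X,
        chartQuotMap_C, t1, t2, abar, bbar]
      ring
    have hrs : IsRsopPart (consFamily c 0 L (chartBase c 0) (killFamily 0 (chartGen c 0) [] f)) := by
      rcases lineChart_zero_partial c a b hD 𝔓 hnl with h1 | h2
      · exact isRsopPart_lineKill c w hz hd 0 𝔓 h𝔓 L [] List.nodup_nil (by simp) f hf F hF0 hfF t1 _ hG1 h1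
      · exact isRsopPart_lineKill c w hz hd 0 𝔓 h𝔓 L [] List.nodup_nil (by simp) f hf F hF0 hfF t2 _ hG2 h2
    exact rsopAdapted_of_consFamily_killFamily₃ c 0 𝔓 L [] f hrs _ (fun g hg _ => by
      simp only [List.mem_cons, List.not_mem_nil, or_false] at hg
      rcases hg with rfl | rfl
      · exact Or.inl rfl
      · exact Or.inr (Or.inr rfl))
  · have hrs := isRsopPart_lineChartFamily c w hz hd 0 𝔓 h𝔓 L (m := 0) (fun k => k.elim0)
      (Function.injective_of_subsingleton _) (fun k => k.elim0)
    exact rsopAdapted_of_lineChartFamily c w 0 𝔓 L _ hrs _ (fun g hg hgP => by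
      simp only [List.mem_cons, List.not_mem_nil, or_false] at hg
      rcases hg with rfl | rfl
      · exact Or.inl rfl
      · exact absurd hgP hf)

include hz hd h𝔓 in
/-- **At the line point of chart `0`** (`e₁, e₂ ∈ 𝔓`): `(φ c₀, e₁, e₂; φ w)` (the tree's `chartFamily` at the two indices `1, 2`) is part
of a regular system of parameters of `L`, with `v₀ = φ c₀`, `v₁ = e₁`, `v₂ = e₂`. [cite: StacksProject, Tag 0BIQ] -/
theorem lineVertex (h1 : chartGen c 0 1 ∈ 𝔓) (h2 : chartGen c 0 2 ∈ 𝔓) :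
    IsRsopPart (chartFamily c 0 w L (chartBase c 0) (chartGen c 0)
        (fun k : Fin 2 => (⟨k.succ, Fin.succ_ne_zero k⟩ : {j : Fin 3 // j ≠ (0 : Fin 3)}))) ∧
      chartFamily c 0 w L (chartBase c 0) (chartGen c 0)
          (fun k : Fin 2 => (⟨k.succ, Fin.succ_ne_zero k⟩ : {j : Fin 3 // j ≠ (0 : Fin 3)})) 0 =
        (algebraMap (chartRing c 0) L : chartRing c 0 →+* L) (chartBase c 0 (c 0)) ∧
      chartFamily c 0 w L (chartBase c 0) (chartGen c 0)
          (fun k : Fin 2 => (⟨k.succ, Fin.succ_ne_zero k⟩ : {j : Fin 3 // j ≠ (0 : Fin 3)})) (Fin.succ (Fin.castAdd l 0)) =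
        (algebraMap (chartRing c 0) L : chartRing c 0 →+* L) (chartGen c 0 1) ∧
      chartFamily c 0 w L (chartBase c 0) (chartGen c 0)
          (fun k : Fin 2 => (⟨k.succ, Fin.succ_ne_zero k⟩ : {j : Fin 3 // j ≠ (0 : Fin 3)})) (Fin.succ (Fin.castAdd l 1)) =
        (algebraMap (chartRing c 0) L : chartRing c 0 →+* L) (chartGen c 0 2) := by
  have hjJ : Function.Injective (fun k : Fin 2 => (⟨k.succ, Fin.succ_ne_zero k⟩ : {j : Fin 3 // j ≠ (0 : Fin 3)})) :=
    fun k k' h => Fin.succ_injective _ (congrArg Subtype.val h)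
  have hJ : ∀ k : Fin 2, chartGen c 0 ((fun k : Fin 2 => (⟨k.succ, Fin.succ_ne_zero k⟩ : {j : Fin 3 // j ≠ (0 : Fin 3)})) k).1 ∈ 𝔓 := by
    intro k; fin_cases k
    exacts [h1, h2]
  refine ⟨isRsopPart_lineChartFamily c w hz hd 0 𝔓 h𝔓 L _ hjJ hJ, rfl, ?_, ?_⟩
  · rw [chartFamily, Fin.cons_succ, Fin.append_left]; rfl
  · rw [chartFamily, Fin.cons_succ, Fin.append_left]; rfl

end LineChartZero

end ConeDepth

end Summit.ResolutionOfSingularities.ResolutionOfSingularities.Theorems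

end
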